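import Mathlib.MeasureTheory.Measure.HasOuterApproxClosed
import Mathlib.Topology.TietzeExtension
import Summits.AnomalousDissipation.AnomalousDissipation.Theorems.BaireTransferDenseLoudDesignerForcesErgodicLine
import Summits.AnomalousDissipation.AnomalousDissipation.Theorems.BaireTransferDenseLoudDesignerForcesStubBirkhoffMeans
import Literature.Analysis.FluidPDE.TimeAverageMeasureExistence
import HarnessLib

/-!
# Stub `stub_invariantMeasureOfTrajectory` of the line `SketchIdeator2` (card `separatrix-flux-pinning`)
# (crux `MarginalStabilityChain.ChainRealisation`, stmt-AnomalousDissipation-14249)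

Sorry-free discharge of the registered stub `stub_invariantMeasureOfTrajectory` (E2a) of the lead's skeleton
(`Cruxes/ChainRealisation/Lines/SketchIdeator2.lean`, §2 `eternalisationZM_of`) over the landed ergodic vocabulary
`Theorems/BaireTransferDenseLoudDesignerForcesErgodicLine.lean` (`Hsp`, `rep`, `enstrophyObs`, `energyAvg`,
`dissipAvg`, `IsNSPhase`, `IsInvariantMeasure`).

**Statement (Krylov–Bogoliubov along one trajectory, with the limsup).**  For an NS phase `(K, φ)` (compact
forward-invariant `K ⊂ H`, jointly continuous semiflow on `Ici 0 × K`, enstrophy finite and continuous on `K`) and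
`x₀ ∈ K` there is an invariant Borel probability measure `μ` carried by `K` whose ensemble dissipation
`ν (∫⁻ ‖∇u‖² dμ).toReal` EQUALS `limsup_T T⁻¹∫₀ᵀ ν‖∇φ_t x₀‖² dt` and whose ensemble energy `∫ ‖u‖² dμ` is at most
`limsup_T T⁻¹∫₀ᵀ ‖φ_t x₀‖² dt`.

**Proof** (Foias–Manley–Rosa–Temam 2001, Ch. IV §1.3 and §3.1, for a semiflow on a compact set).
* A generalized (Banach) limit `Λ` whose long-time average of the ONE bounded function `t ↦ ν‖∇φ_t x₀‖²`
  is its `limsup` average, `Λ (dissipAvg ν φ x₀) = limsup (dissipAvg ν φ x₀)`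
  (`stub_invariantMeasure_aux_exists_longTimeAvg_eq_longTimeAvgSup`: the Cesàro means `h` are bounded, `limsup h` is a
  cluster value of `h` at `+∞` — Mathlib `MapClusterPt.limsup` —, i.e. the limit of `h` along an ultrafilter
  `𝒰 ≤ atTop`, and the `𝒰`-limit, extended linearly from the `𝒰`-convergent functions, is a generalized limit: the
  tree's `GeneralizedLimit.nonempty_holds` with `𝒰` as a parameter, as in
  `Theorems/TaylorCertificatesEnsembleCeilingTransfer.lean`, which is not imported because it depends on another
  route's thesis file).
* The time-average measure of the orbit `t ↦ φ_t x₀` for `Λ` (`…_aux_exists_timeAverageMeasure`): the functional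
  `Ψ ↦ Λ(T ↦ T⁻¹∫₀ᵀ Ψ(φ_t x₀) dt)` on `C_b(H)` is linear (`Torus.exists_linearMap_longTimeAvg`), positive, normalised
  and TIGHT — it vanishes on every `Ψ` vanishing on the compact `K ⊇ orbit` —, so the tree's representation theorem
  `RieszRepresentation.exists_probabilityMeasure_of_isTightFunctional` on the Polish space `H` produces `μ`; it is
  carried by `K` (`Torus.IsTimeAverageMeasure.measure_compl_eq_zero`) and its defining identity extends to every
  observable continuous on `K` (Tietze, `…_aux_exists_bcf`, and `Torus.IsTimeAverageMeasure.integral_eq_of_eqOn`).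
* Invariance `(φ_s)_* μ = μ`, `s ≥ 0` (`…_aux_map_eq`): for `Ψ ∈ C_b(H)` the Cesàro means of `t ↦ Ψ(φ_{t+s} x₀)` and
  of `t ↦ Ψ(φ_t x₀)` differ by `O(s‖Ψ‖/T)` (`…_aux_timeMean_shift_tendsto`), so `∫ Ψ ∘ φ_s dμ = ∫ Ψ dμ`, and finite
  Borel measures on a metric space are determined by the integrals of bounded continuous functions
  (Mathlib `ext_of_forall_integral_eq_of_IsFiniteMeasure`).
* Budgets: `∫ enstrophyObs dμ = (ensembleEnstrophy μ).toReal` on measures carried by `K`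
  (`stub_birkhoffMeans_aux_integral_enstrophyObs`, landed), so `ensembleDissipation ν μ = Λ (dissipAvg ν φ x₀) =
  limsup`; and `ensembleEnergy μ = Λ (energyAvg φ x₀) ≤ limsup` by the upper half of the sandwich.

References: C. Foias, O. Manley, R. Rosa, R. Temam, *Navier–Stokes Equations and Turbulence* (CUP 2001), Ch. IV
§1.3 Def. 1.4, App. A.2 (generalized limits), §3.1 Prop. 3.1, Cor. 3.1 (time-average measures); N. Krylov,
N. Bogoliubov, Ann. of Math. 38 (1937) 65–113 (invariant measures of compact dynamical systems); C. Berg,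
J. P. R. Christensen, P. Ressel, *Harmonic Analysis on Semigroups* (Springer 1984), Ch. 2 Thm. 2.2.
-/

set_option linter.dupNamespace false

noncomputable section

open MeasureTheory Set Filter Topology
open scoped InnerProductSpace
open Literature.Analysis.FunctionSpaces Literature.Analysis.FunctionSpaces.Torus
open Literature.Analysis.FluidPDE

namespace Summit.AnomalousDissipation.AnomalousDissipation.Theorems.ChainRealisation.SeparatrixFluxPinning

open Summit.AnomalousDissipation.AnomalousDissipation.Theorems.DenseLoudDesignerForces.Ergodic
open Literature.Analysis.FluidPDE.Torus

/-- Local notation: the torus `T³`. -/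
local notation "𝕋³" => UnitAddTorus (Fin 3)
/-- Local notation: velocity values. -/
local notation "E³" => EuclideanSpace ℝ (Fin 3)
/-- Local notation: the planar torus `T²`. -/
local notation "𝕋²" => UnitAddTorus (Fin 2)
/-- Local notation: planar velocity values. -/
local notation "E²" => EuclideanSpace ℝ (Fin 2)

open scoped ENNReal BoundedContinuousFunction

/-! ## A generalized long-time average attaining one prescribed `limsup` average -/

-- adapted from `Theorems/TaylorCertificatesEnsembleCeilingTransfer.lean` (`exists_generalizedLimit_of_ultrafilter`,
-- `exists_generalizedLimit_apply_eq_limsup`); not imported: that module depends on another route's thesis file.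
/-- **A generalized long-time average attaining the `limsup` average of one bounded function** (Doering–Foias 2002,
§2: "`Lim` may be chosen so that `⟨‖∇u‖²⟩ = limsup`"; FMRT 2001, Ch. IV §1.3 Def. 1.4 and App. A.2).  If `|g| ≤ C` on
`(0, ∞)` there is a generalized limit `Λ` with `Λ(T ↦ T⁻¹∫₀ᵀ g) = limsup_T T⁻¹∫₀ᵀ g`: the Cesàro means `h` of `g` are
eventually bounded, so `limsup h` is a cluster value of `h` at `+∞` (Mathlib `MapClusterPt.limsup`), i.e. the limit of
`h` along an ultrafilter `𝒰` finer than `atTop` (`mapClusterPt_iff_ultrafilter`); the `𝒰`-limit is linear on the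
`𝒰`-convergent functions (`GeneralizedLimit.limAlong`), any linear extension (`LinearMap.exists_extend`) returns on an
eventually bounded function a cluster value at `+∞`, which lies in `[liminf, limsup]`, so it is a generalized limit. -/
theorem stub_invariantMeasure_aux_exists_longTimeAvg_eq_longTimeAvgSup {g : ℝ → ℝ} {C : ℝ}
    (hg : ∀ t, 0 < t → |g t| ≤ C) : ∃ Λ : GeneralizedLimit, Λ.longTimeAvg g = longTimeAvgSup g := by
  classical
  -- the Cesàro means and an ultrafilter along which they converge to their `limsup`
  have hb₁ : IsBoundedUnder (· ≤ ·) atTop (timeMean g) := isBoundedUnder_le_timeMean hg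
  have hb₂ : IsBoundedUnder (· ≥ ·) atTop (timeMean g) := isBoundedUnder_ge_timeMean hg
  have hcl : MapClusterPt (limsup (timeMean g) atTop) atTop (timeMean g) :=
    MapClusterPt.limsup hb₂.isCoboundedUnder_le hb₁
  obtain ⟨𝒰, h𝒰, hT⟩ := mapClusterPt_iff_ultrafilter.1 hcl
  -- a linear extension of the `𝒰`-limit
  obtain ⟨Λ, hΛ⟩ := LinearMap.exists_extend (GeneralizedLimit.limAlong (↑𝒰 : Filter ℝ))
  have hext : ∀ (k : ℝ → ℝ) (c : ℝ), Tendsto k (↑𝒰 : Filter ℝ) (𝓝 c) → Λ k = c := by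
    intro k c hcT
    have hΛk := LinearMap.congr_fun hΛ ⟨k, ⟨c, hcT⟩⟩
    rw [LinearMap.comp_apply, Submodule.subtype_apply] at hΛk
    exact hΛk.trans (GeneralizedLimit.limAlong_eq_of_tendsto _ hcT)
  -- it is a generalized limit
  have key : ∀ k : ℝ → ℝ, IsBoundedUnder (· ≤ ·) atTop k → IsBoundedUnder (· ≥ ·) atTop k →
      ∃ c, liminf k atTop ≤ c ∧ c ≤ limsup k atTop ∧ Λ k = c := by
    intro k h₁ h₂
    obtain ⟨b, hb⟩ := id h₁
    obtain ⟨a, ha⟩ := id h₂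
    have hb' : ∀ᶠ t in atTop, k t ≤ b := hb
    have ha' : ∀ᶠ t in atTop, a ≤ k t := ha
    have hmem : ∀ᶠ t in (↑𝒰 : Filter ℝ), k t ∈ Set.Icc a b :=
      (by filter_upwards [ha', hb'] with t hta htb using ⟨hta, htb⟩ :
        ∀ᶠ t in atTop, k t ∈ Set.Icc a b).filter_mono h𝒰
    obtain ⟨c, -, hc⟩ := isCompact_Icc.ultrafilter_le_nhds' (𝒰.map k) (mem_map.1 hmem)
    have hcT : Tendsto k (↑𝒰 : Filter ℝ) (𝓝 c) := hc
    have hck : MapClusterPt c atTop k := mapClusterPt_iff_ultrafilter.2 ⟨𝒰, h𝒰, hcT⟩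
    exact ⟨c, hck.liminf_le h₂, hck.le_limsup h₁, hext k c hcT⟩
  refine ⟨⟨Λ, fun k h₁ h₂ => ?_, fun k h₁ h₂ => ?_⟩, hext _ _ hT⟩
  · obtain ⟨c, hc₁, -, hc₃⟩ := key k h₁ h₂
    rw [hc₃]
    exact hc₁
  · obtain ⟨c, -, hc₂, hc₃⟩ := key k h₁ h₂
    rw [hc₃]
    exact hc₂

/-! ## Cesàro means do not see a time shift -/

/-- **Cesàro means of a shifted bounded function.**  If `|h| ≤ M` on `[0, ∞)`, `h` is integrable on the compact
subintervals of `[0, ∞)` and `s ≥ 0`, then `T⁻¹∫₀ᵀ h(t + s) dt - T⁻¹∫₀ᵀ h(t) dt = T⁻¹(∫_T^{T+s} h - ∫₀ˢ h) = O(2Ms/T) → 0`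
(FMRT 2001, Ch. IV §3.1, proof of Thm. 3.1: time-average measures of a semiflow are invariant). -/
theorem stub_invariantMeasure_aux_timeMean_shift_tendsto {h : ℝ → ℝ} {M s : ℝ} (hs : 0 ≤ s)
    (hM : ∀ t, 0 ≤ t → |h t| ≤ M)
    (hint : ∀ a b : ℝ, 0 ≤ a → a ≤ b → IntervalIntegrable h volume a b) :
    Tendsto (fun T => timeMean (fun t => h (t + s)) T - timeMean h T) atTop (𝓝 0) := by
  have hlim : Tendsto (fun T : ℝ => 2 * M * s * T⁻¹) atTop (𝓝 0) := by
    simpa using tendsto_inv_atTop_zero.const_mul (2 * M * s)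
  refine squeeze_zero_norm' ?_ hlim
  filter_upwards [eventually_gt_atTop 0] with T hT
  have h1 : ∫ t in (0 : ℝ)..T, h (t + s) = ∫ t in s..(T + s), h t := by
    rw [intervalIntegral.integral_comp_add_right h s, zero_add]
  have h2 : (∫ t in s..(T + s), h t) - ∫ t in (0 : ℝ)..T, h t =
      (∫ t in T..(T + s), h t) - ∫ t in (0 : ℝ)..s, h t := by
    have e1 := intervalIntegral.integral_add_adjacent_intervals (hint 0 s le_rfl hs)
      (hint s (T + s) hs (by linarith))
    have e2 := intervalIntegral.integral_add_adjacent_intervals (hint 0 T le_rfl hT.le)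
      (hint T (T + s) hT.le (by linarith))
    linarith
  have hb : ∀ a b : ℝ, 0 ≤ a → a ≤ b → |∫ t in a..b, h t| ≤ M * (b - a) := by
    intro a b ha hab
    have h3 : ‖∫ t in a..b, h t‖ ≤ M * |b - a| :=
      intervalIntegral.norm_integral_le_of_norm_le_const fun t ht => by
        rw [uIoc_of_le hab] at ht
        rw [Real.norm_eq_abs]
        exact hM t (ha.trans ht.1.le)
    rwa [Real.norm_eq_abs, abs_of_nonneg (sub_nonneg.2 hab)] at h3
  have hb1 : |∫ t in T..(T + s), h t| ≤ M * s := by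
    simpa using hb T (T + s) hT.le (by linarith)
  have hb2 : |∫ t in (0 : ℝ)..s, h t| ≤ M * s := by
    simpa using hb 0 s le_rfl hs
  rw [Real.norm_eq_abs]
  unfold timeMean
  rw [h1, ← mul_sub, h2, abs_mul, abs_inv, abs_of_pos hT]
  calc T⁻¹ * |(∫ t in T..(T + s), h t) - ∫ t in (0 : ℝ)..s, h t| ≤ T⁻¹ * (M * s + M * s) := by
        gcongr
        exact (abs_sub _ _).trans (add_le_add hb1 hb2)
    _ = 2 * M * s * T⁻¹ := by ring

/-- **Generalized long-time averages are shift invariant on bounded functions**: with `h`, `M`, `s` as in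
`stub_invariantMeasure_aux_timeMean_shift_tendsto`, `Λ.longTimeAvg (h(· + s)) = Λ.longTimeAvg h` for every
generalized limit `Λ` (linearity and `Lim = lim = 0` on the difference of the Cesàro means; FMRT 2001, Ch. IV §3.1). -/
theorem stub_invariantMeasure_aux_longTimeAvg_shift (Λ : GeneralizedLimit) {h : ℝ → ℝ} {M s : ℝ}
    (hs : 0 ≤ s) (hM : ∀ t, 0 ≤ t → |h t| ≤ M)
    (hint : ∀ a b : ℝ, 0 ≤ a → a ≤ b → IntervalIntegrable h volume a b) :
    Λ.longTimeAvg (fun t => h (t + s)) = Λ.longTimeAvg h := by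
  have h0 : Λ (timeMean (fun t => h (t + s)) - timeMean h) = 0 :=
    Λ.apply_eq_of_tendsto (stub_invariantMeasure_aux_timeMean_shift_tendsto hs hM hint)
  rw [map_sub] at h0
  unfold GeneralizedLimit.longTimeAvg
  linarith

/-! ## Observables continuous on the compact `K` -/

/-- **Tietze on the compact `K`.**  A real function continuous on a compact `K ⊆ H` agrees on `K` with a bounded
continuous function on `H` (`K` is closed in the metric, hence normal, space `H`; Mathlib
`BoundedContinuousFunction.exists_norm_eq_restrict_eq_of_closed`). -/
theorem stub_invariantMeasure_aux_exists_bcf {K : Set Hsp} (hKc : IsCompact K) {Ψ : Hsp → ℝ}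
    (hΨ : ContinuousOn Ψ K) : ∃ g : Hsp →ᵇ ℝ, EqOn Ψ g K := by
  haveI : CompactSpace K := isCompact_iff_compactSpace.1 hKc
  set f : K →ᵇ ℝ := BoundedContinuousFunction.mkOfCompact
    ⟨K.restrict Ψ, continuousOn_iff_continuous_restrict.1 hΨ⟩ with hf
  obtain ⟨g, -, hg⟩ := f.exists_norm_eq_restrict_eq_of_closed hKc.isClosed
  refine ⟨g, fun x hx => ?_⟩
  have h1 := congrArg (fun q : K →ᵇ ℝ => q ⟨x, hx⟩) hg
  simp only [BoundedContinuousFunction.restrict_apply, hf, BoundedContinuousFunction.mkOfCompact_apply,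
    ContinuousMap.coe_mk, restrict_apply] at h1
  exact h1.symm

/-! ## The time-average measure of one phase trajectory -/

section Orbit

variable {ν : ℝ} {F : 𝕋³ → E³} {K : Set Hsp} {φ : ℝ → Hsp → Hsp} {x₀ : Hsp}

/-- The orbit `t ↦ φ_t x₀` of a point of `K` is continuous on `[0, ∞)`, hence a.e. strongly measurable on
`(0, ∞)`. -/
theorem stub_invariantMeasure_aux_orbit_aestronglyMeasurable (hK : IsNSPhase ν F K φ) (hx₀ : x₀ ∈ K) :
    AEStronglyMeasurable (fun t : ℝ => φ t x₀) (volume.restrict (Ioi (0 : ℝ))) := by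
  have h0 : Continuous fun t : ℝ => ((t, x₀) : ℝ × Hsp) := by fun_prop
  have h1 : ContinuousOn (fun t : ℝ => φ t x₀) (Ici 0) :=
    hK.continuousOn.comp h0.continuousOn fun t ht => ⟨ht, hx₀⟩
  exact (h1.mono Ioi_subset_Ici_self).aestronglyMeasurable measurableSet_Ioi

/-- **Time-average measure of a phase trajectory** (FMRT 2001, Ch. IV §3.1 Prop. 3.1, for a semiflow on a compact
set; Krylov–Bogoliubov 1937).  For `x₀ ∈ K` and a generalized limit `Λ` there is a Borel probability measure `μ` on
`H` with `∫ Ψ dμ = Λ(T ↦ T⁻¹∫₀ᵀ Ψ(φ_t x₀) dt)` for every bounded continuous `Ψ`: the right-hand side is a positive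
normalised linear functional on `C_b(H)` (`Torus.exists_linearMap_longTimeAvg`), tight because it vanishes on
functions vanishing on the compact `K ⊇ orbit`, and `H` is Polish, so the tree's representation theorem
`RieszRepresentation.exists_probabilityMeasure_of_isTightFunctional` (Berg–Christensen–Ressel 1984, Ch. 2 Thm. 2.2)
applies. -/
theorem stub_invariantMeasure_aux_exists_timeAverageMeasure (hK : IsNSPhase ν F K φ) (hx₀ : x₀ ∈ K)
    (Λ : GeneralizedLimit) :
    ∃ μ : Measure Hsp, IsTimeAverageMeasure Λ.longTimeAvg (fun t => φ t x₀) μ := by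
  classical
  haveI : Fact ((2 : ℝ≥0∞) ≠ ∞) := ⟨ENNReal.ofNat_ne_top⟩
  haveI : SecondCountableTopology (Lp E³ 2 (volume : Measure 𝕋³)) := inferInstance
  haveI : SecondCountableTopology Hsp := TopologicalSpace.Subtype.secondCountableTopology _
  haveI : PolishSpace Hsp := inferInstance
  obtain ⟨L, hL⟩ :=
    Torus.exists_linearMap_longTimeAvg Λ (stub_invariantMeasure_aux_orbit_aestronglyMeasurable hK hx₀)
  have hpos : ∀ g : Hsp →ᵇ ℝ, (∀ x, 0 ≤ g x) → 0 ≤ L g := by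
    intro g hg
    rw [hL]
    exact Λ.longTimeAvg_nonneg (fun t => hg (φ t x₀)) (C := ‖g‖) fun t _ => by
      rw [← Real.norm_eq_abs]
      exact g.norm_coe_le_norm (φ t x₀)
  have hone : L 1 = 1 := by
    rw [hL]
    exact Λ.longTimeAvg_one
  have htight : Literature.MeasureTheory.RieszRepresentation.IsTightFunctional L := by
    intro ε hε
    refine ⟨K, hK.isCompact, fun g hg => ?_⟩
    have h0 : Λ.longTimeAvg (fun t => g (φ t x₀)) = Λ.longTimeAvg (fun _ => (0 : ℝ)) :=
      Λ.longTimeAvg_congr fun t ht => hg _ (hK.mapsTo t ht.le hx₀)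
    have h1 : timeMean (fun _ : ℝ => (0 : ℝ)) = fun _ => 0 := by
      funext T
      simp [timeMean]
    have h2 : Λ.longTimeAvg (fun _ => (0 : ℝ)) = 0 := by
      rw [GeneralizedLimit.longTimeAvg, h1, Λ.apply_const]
    rw [hL, h0, h2, abs_zero]
    positivity
  obtain ⟨μ, hμ, hint⟩ :=
    Literature.MeasureTheory.RieszRepresentation.exists_probabilityMeasure_of_isTightFunctional L hpos
      htight hone
  refine ⟨μ, hμ, fun Ψ hΨc hΨb => ?_⟩
  obtain ⟨C, hC⟩ := hΨb.exists_norm_le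
  set g : Hsp →ᵇ ℝ := BoundedContinuousFunction.ofNormedAddCommGroup Ψ hΨc C fun x => hC _ ⟨x, rfl⟩ with hg
  have h := hint g
  rw [hL] at h
  simpa only [hg, BoundedContinuousFunction.coe_ofNormedAddCommGroup] using h

variable {Λ : GeneralizedLimit} {μ : Measure Hsp}

/-- A time-average measure of the orbit of `x₀ ∈ K` is carried by `K` (the orbit stays in the closed `K`;
`Torus.IsTimeAverageMeasure.measure_compl_eq_zero`, FMRT 2001, Ch. IV §3.1 Prop. 3.1). -/
theorem stub_invariantMeasure_aux_null_compl (hK : IsNSPhase ν F K φ) (hx₀ : x₀ ∈ K)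
    (hμ : IsTimeAverageMeasure Λ.longTimeAvg (fun t => φ t x₀) μ) : μ Kᶜ = 0 :=
  hμ.measure_compl_eq_zero hK.isCompact.isClosed le_rfl fun t ht => hK.mapsTo t ht hx₀

/-- **The defining identity for observables continuous on `K`** (FMRT 2001, Ch. IV §3.1 Cor. 3.1): for a
time-average measure `μ` of the orbit of `x₀ ∈ K` and `Ψ` continuous on `K`, `Ψ` is `μ`-integrable and
`∫ Ψ dμ = Λ(T ↦ T⁻¹∫₀ᵀ Ψ(φ_t x₀) dt)` (`Ψ` agrees on `K`, which carries `μ` and contains the orbit, with a bounded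
continuous function, by Tietze). -/
theorem stub_invariantMeasure_aux_integral_eq (hK : IsNSPhase ν F K φ) (hx₀ : x₀ ∈ K)
    (hμ : IsTimeAverageMeasure Λ.longTimeAvg (fun t => φ t x₀) μ) {Ψ : Hsp → ℝ} (hΨ : ContinuousOn Ψ K) :
    Integrable Ψ μ ∧ ∫ v, Ψ v ∂μ = Λ.longTimeAvg (fun t => Ψ (φ t x₀)) := by
  obtain ⟨g, hg⟩ := stub_invariantMeasure_aux_exists_bcf hK.isCompact hΨ
  exact hμ.integral_eq_of_eqOn hK.isCompact.isClosed (fun t ht => hK.mapsTo t ht hx₀) g.continuous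
    (C := ‖g‖) (fun u => by rw [← Real.norm_eq_abs]; exact g.norm_coe_le_norm u) hg

/-- **Invariance of the time-average measure of a trajectory** (FMRT 2001, Ch. IV §3.1 Thm. 3.1 in the compact
setting; Krylov–Bogoliubov 1937): `(φ_s)_* μ = μ` for `s ≥ 0`.  For `Ψ ∈ C_b(H)`,
`∫ Ψ ∘ φ_s dμ = Λ(T ↦ T⁻¹∫₀ᵀ Ψ(φ_{t+s} x₀) dt) = Λ(T ↦ T⁻¹∫₀ᵀ Ψ(φ_t x₀) dt) = ∫ Ψ dμ` (semigroup law on `K`, the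
shifted Cesàro means differ by `O(1/T)`), and finite Borel measures on the metric space `H` are determined by such
integrals. -/
theorem stub_invariantMeasure_aux_map_eq (hK : IsNSPhase ν F K φ) (hx₀ : x₀ ∈ K)
    (hμ : IsTimeAverageMeasure Λ.longTimeAvg (fun t => φ t x₀) μ) {s : ℝ} (hs : 0 ≤ s) :
    Measure.map (φ s) μ = μ := by
  haveI := hμ.1
  have hKm : MeasurableSet K := hK.isCompact.isClosed.measurableSet
  have hae : ∀ᵐ x ∂μ, x ∈ K := by
    have h : μ {x | ¬ x ∈ K} = 0 := stub_invariantMeasure_aux_null_compl hK hx₀ hμ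
    exact ae_iff.2 h
  have hres : μ.restrict K = μ := Measure.restrict_eq_self_of_ae_mem hae
  have h0 : Continuous fun y : Hsp => ((s, y) : ℝ × Hsp) := by fun_prop
  have hcs : ContinuousOn (φ s) K := hK.continuousOn.comp h0.continuousOn fun y hy => ⟨hs, hy⟩
  have hφm : AEMeasurable (φ s) μ := by
    rw [← hres]
    exact hcs.aemeasurable hKm
  refine ext_of_forall_integral_eq_of_IsFiniteMeasure fun f => ?_
  rw [integral_map hφm f.continuous.aestronglyMeasurable,
    (stub_invariantMeasure_aux_integral_eq hK hx₀ hμ (Ψ := fun x => f (φ s x))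
      (f.continuous.comp_continuousOn hcs)).2,
    (stub_invariantMeasure_aux_integral_eq hK hx₀ hμ (Ψ := fun x => f x) f.continuous.continuousOn).2]
  have h1 : Λ.longTimeAvg (fun t => f (φ s (φ t x₀))) = Λ.longTimeAvg (fun t => f (φ (t + s) x₀)) :=
    Λ.longTimeAvg_congr fun t ht => by rw [add_comm t s, hK.map_add s t hs ht.le x₀ hx₀]
  rw [h1]
  exact stub_invariantMeasure_aux_longTimeAvg_shift Λ hs (M := ‖f‖)
    (fun t _ => by rw [← Real.norm_eq_abs]; exact f.norm_coe_le_norm _)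
    fun a b ha hab => stub_birkhoffMeans_aux_intervalIntegrable hK f.continuous.continuousOn hx₀ ha hab

/-- A time-average measure of the orbit of `x₀ ∈ K` is an invariant probability measure of the NS phase carried by
`K` (Krylov–Bogoliubov 1937; FMRT 2001, Ch. IV §3.1). -/
theorem stub_invariantMeasure_aux_isInvariantMeasure (hK : IsNSPhase ν F K φ) (hx₀ : x₀ ∈ K)
    (hμ : IsTimeAverageMeasure Λ.longTimeAvg (fun t => φ t x₀) μ) : IsInvariantMeasure K φ μ where
  prob := hμ.1
  null_compl := stub_invariantMeasure_aux_null_compl hK hx₀ hμ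
  map_eq _ hs := stub_invariantMeasure_aux_map_eq hK hx₀ hμ hs

end Orbit

/-! ## The stub -/

/-- **Stub E2a of the line `SketchIdeator2`: KRYLOV–BOGOLIUBOV WITH THE LIMSUP.**  A trajectory of an NS phase
`(K, φ)` started at `x₀ ∈ K` carries an invariant Borel probability measure `μ` on `K` whose ensemble dissipation
EQUALS `limsup_T T⁻¹∫₀ᵀ ν‖∇φ_t x₀‖² dt` and whose ensemble energy is at most `limsup_T T⁻¹∫₀ᵀ ‖φ_t x₀‖² dt`: the
time-average measure of the orbit for a generalized limit `Λ` chosen to realise the `limsup` of the (bounded)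
dissipation means; the observables `enstrophyObs` and `‖·‖²` are continuous on the compact `K`, which carries `μ`
(FMRT 2001, Ch. IV §1.3, §3.1). -/
theorem stub_invariantMeasureOfTrajectory :
    ∀ (ν : ℝ) (F : 𝕋³ → E³) (K : Set Hsp) (φ : ℝ → Hsp → Hsp) (x₀ : Hsp),
      0 ≤ ν → IsNSPhase ν F K φ → x₀ ∈ K →
      ∃ μ : Measure Hsp, IsInvariantMeasure K φ μ ∧
        ensembleDissipation ν μ = limsup (dissipAvg ν φ x₀) atTop ∧
        ensembleEnergy μ ≤ limsup (energyAvg φ x₀) atTop := by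
  intro ν F K φ x₀ _hν hK hx₀
  -- the dissipation means are bounded: choose `Λ` realising their `limsup`
  obtain ⟨C, hC⟩ := hK.isCompact.exists_bound_of_continuousOn hK.enstrophy_continuousOn
  have hbD : ∀ t, 0 < t → |ν * enstrophyObs (φ t x₀)| ≤ |ν| * C := fun t ht => by
    rw [abs_mul]
    exact mul_le_mul_of_nonneg_left (by rw [← Real.norm_eq_abs]; exact hC _ (hK.mapsTo t ht.le hx₀))
      (abs_nonneg ν)
  obtain ⟨Λ, hΛ⟩ := stub_invariantMeasure_aux_exists_longTimeAvg_eq_longTimeAvgSup hbD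
  -- the time-average measure of the orbit for `Λ`
  obtain ⟨μ, hμ⟩ := stub_invariantMeasure_aux_exists_timeAverageMeasure hK hx₀ Λ
  have hinv : IsInvariantMeasure K φ μ := stub_invariantMeasure_aux_isInvariantMeasure hK hx₀ hμ
  refine ⟨μ, hinv, ?_, ?_⟩
  · -- dissipation: `ν (∫⁻ ‖∇u‖² dμ).toReal = ν ∫ enstrophyObs dμ = Λ (dissipAvg ν φ x₀) = limsup`
    show ν * (ensembleEnstrophy μ).toReal = longTimeAvgSup (fun t => ν * enstrophyObs (φ t x₀))
    rw [← stub_birkhoffMeans_aux_integral_enstrophyObs hK hinv,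
      (stub_invariantMeasure_aux_integral_eq hK hx₀ hμ hK.enstrophy_continuousOn).2,
      ← Λ.longTimeAvg_const_mul]
    exact hΛ
  · -- energy: `∫ ‖u‖² dμ = Λ (energyAvg φ x₀) ≤ limsup`
    have hcont : ContinuousOn (fun u : Hsp => ‖u‖ ^ 2) K := (continuous_norm.pow 2).continuousOn
    obtain ⟨C', hC'⟩ := hK.isCompact.exists_bound_of_continuousOn hcont
    have hbE : ∀ t, 0 < t → |‖φ t x₀‖ ^ 2| ≤ C' := fun t ht => by
      rw [← Real.norm_eq_abs]
      exact hC' _ (hK.mapsTo t ht.le hx₀)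
    have hE : energyAvg φ x₀ = timeMean (fun t => ‖φ t x₀‖ ^ 2) := rfl
    have hE₁ : IsBoundedUnder (· ≤ ·) atTop (energyAvg φ x₀) := hE ▸ isBoundedUnder_le_timeMean hbE
    have hE₂ : IsBoundedUnder (· ≥ ·) atTop (energyAvg φ x₀) := hE ▸ isBoundedUnder_ge_timeMean hbE
    show ∫ u, ‖u‖ ^ 2 ∂μ ≤ _
    rw [(stub_invariantMeasure_aux_integral_eq hK hx₀ hμ hcont).2]
    exact Λ.le_limsup hE₁ hE₂

end Summit.AnomalousDissipation.AnomalousDissipation.Theorems.ChainRealisation.SeparatrixFluxPinning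

end
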